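import Summits.ABC.IUTFork.Joshi.AdelicAnsatz
import Summits.ABC.IUTFork.Joshi.AdelicAnsatzPeriod
import Mathlib.Topology.ContinuousOn
import HarnessLib

/-!
# Joshi, ATS III §4: MERGE-DEBT RECONCILIATION between slot T-07's carrier `AdelicCurveDatum`
# (`Joshi/AdelicAnsatz.lean`, [J-III] §4.1–4.2) and slot T-08's `AnsatzCurveDatum` / `ArithPeriodDatum`
# (`Joshi/AnsatzStandardPoint.lean`, `Joshi/AdelicAnsatzPeriod*.lean`, [J-III] §4.3–4.6) — block E, file 4 of T-08 (part 1)

Both carriers type K. Joshi, *Construction of Arithmetic Teichmüller Spaces III*, arXiv:2401.13508v4 («[J-III]»,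
unrefereed) §4 and landed minutes apart under the INTERIM CARRIER RULE (plan/E/ASSIGNMENTS.md §0.3; E-PLAN R12:
"later filer imports the earlier landed structure BY NAME, no renames"). This file pays the debt WITHOUT renaming
anything: from T-07's `AdelicCurveDatum D` (places `𝕍_{L′}`, `V^{odd,ss}`, the curves `|Y_{C♭_p,L′_w}|`, the forgetful
map (4.2.1.2), `G_{L′}`, `ϕ`, `L′*`, the residue valuations `absK` on a common evaluation domain `T p`, and
MOCHIZUKI'S ADELIC ANSATZ `adelicAnsatz` DEFINED by Def. 4.2.2) plus the extra data §4.3–4.6 need and T-07 does not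
carry — `StandardPointData` (`V^non`, `|X_{C♭_p,L′_w}|`, the quotient map, the canonical points: §4.4) and
`ResidueFieldData` (the residue fields `K_{y_w}` with `|−|`, `L′ ↪ K_{y_w}`, normalization coordinates, standard
absolute values: [J-IIh] = arXiv:2305.10398 Def. 5.1.1, §5.3, and an evaluation `L′ → T p_w` making T-07's `absK`
and T-08's `abs ∘ emb` agree) — it BUILDS T-08's carriers (`toAnsatzCurveDatum`, `toArithPeriodDatum`) with
`ansatz := D.adelicAnsatz`, and PROVES that T-08's hypothesis predicate `IsDiagonalOffBad` is T-07's diagonal clause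
(`isDiagonalOffBad_of_mem`: `z ∈ D.adelicAnsatz → IsDiagonalOffBad z`, Def. 4.2.2), and renders §4.5's "standard Θ-Link"
as T-07's `ThetaGauLink` (`standardThetaGauLink`). The valuation-level reconciliation (`DiagonalOnL` /
`ScalingOnL` from T-07's `valuationConstantOffSS_holds` / `ValuationScaling`, and the transfer of `alpha_scaling` /
`hyperplane_first_ne` to T-07's Ansatz points) is the sequel `Joshi/AdelicAnsatzPeriodBridgeScaling.lean`, which
needs `Joshi/AdelicAnsatzPeriodScaling.lean`. Section 3 types the remaining sub-items of [J-III] Rmk. 4.6.2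
(p.37 l.46–p.38 l.8) as declarations (JOSHI-DAG rows J3:Rmk4.6.2(1)–(3)): (1) the author's continuity
EXPECTATION for the period mapping (`PeriodMapContinuousOn`, a Prop over a topologised codomain — an expectation,
not a claim, hence untagged), (2) Mochizuki's product-formula discussion (LOCATOR ONLY: [IUTchIII] Rmk. 3.9.6,
[IUTchI] Rmk. 5.2.1, [Mochizuki 2020, p.71] — recorded in the docstring of (3), no declaration), (3) "the tuple of
realified Frobenioids `(Frob(L)^ℝ_1, …, Frob(L)^ℝ_{ℓ⋇})` … provides, by the same degree mapping, the hyperplanes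
considered here" (`FrobenioidDegreesGiveHyperplanes`, a claim-Prop over ABSTRACT degree functionals; OUR nearest
object `Summit.ABC.IUTFork.Thm311.GlobalDegrees.deg` / `DegreesViaLogvol` is named, NOT bound — dictionary-support
row D-12, E-PLAN R14). Kernel glue only: no Joshi claim is asserted; TAKES NO SIDE on [IUTchIII] Cor. 3.12 or on
any author; typed ≠ proved. No `Cor312*`/`Thm311*` import. Standard axioms only; sorry-free. Seat abc-iut-E-t8
(rung LADDER-ABC:A2.E).
-/

noncomputable section

open Set Filter

namespace Summit.ABC.IUTFork.Joshi

namespace AdelicCurveDatum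

variable (D : AdelicCurveDatum)

/-- The data of [J-III] §4.4 over T-07's carrier: `ℓ⋇ ≥ 2` ([J-III] §3.1 (11) "`ℓ ≥ 5`"; T-07 records only `ℓ⋇ ≥ 1`),
`V^non_{L′} ⊇ V^{odd,ss}_{L′}`, the closed classical points `|X_{C♭_{p_w},L′_w}|`, the canonical quotient morphism
`Y → X` and the CANONICAL POINT of `X` (p.35 l.46–86). SIGNATURE. [claim: Joshi2024ATS3, status: disputed] -/
structure StandardPointData : Type 1 where
  /-- `ℓ⋇ ≥ 2` -/
  two_le_lstar : 2 ≤ D.lstar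
  /-- `V^non_{L′}` -/
  Vnon : Set D.V
  /-- `V^{odd,ss}_{L′} ⊆ V^non_{L′}` -/
  oddss_subset_Vnon : D.oddss ⊆ Vnon
  /-- `|X_{C♭_{p_w},L′_w}|` -/
  X : D.V → Type
  /-- the canonical quotient morphism on closed classical points -/
  quot : ∀ w, D.Y w → X w
  /-- the canonical point of `X_{C♭_{p_w},L′_w}` -/
  canon : ∀ w, X w

namespace StandardPointData

variable {D} (E : D.StandardPointData)

/-- T-08's carrier `AnsatzCurveDatum` built from T-07's `AdelicCurveDatum` and the §4.4 data, with
`ansatz := D.adelicAnsatz` (Def. 4.2.2 as DEFINED by T-07, no longer abstract). [claim: Joshi2024ATS3, status: disputed] -/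
def toAnsatzCurveDatum : AnsatzCurveDatum where
  lstar := D.lstar
  two_le_lstar := E.two_le_lstar
  V := D.V
  Vnon := E.Vnon
  Voddss := D.oddss
  Voddss_subset_Vnon := E.oddss_subset_Vnon
  Y := D.Y
  X := E.X
  quot := E.quot
  canon := E.canon
  ansatz := D.adelicAnsatz

/-- The Ansatz of the reconciled carrier IS T-07's `adelicAnsatz`. [folklore] -/
@[simp] theorem toAnsatzCurveDatum_ansatz : E.toAnsatzCurveDatum.ansatz = D.adelicAnsatz := rfl

/-- Index bookkeeping: T-08's `first` is T-07's `jOne`. [folklore] -/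
@[simp] theorem toAnsatzCurveDatum_first : E.toAnsatzCurveDatum.first = D.jOne := Fin.ext rfl

/-- Index bookkeeping: T-08's `last` is T-07's `jLast`. [folklore] -/
@[simp] theorem toAnsatzCurveDatum_last : E.toAnsatzCurveDatum.last = D.jLast := Fin.ext rfl

/-- Index bookkeeping: T-08's `jOf` is T-07's `printedIndex`. [folklore] -/
@[simp] theorem toAnsatzCurveDatum_jOf (i : Fin D.lstar) : E.toAnsatzCurveDatum.jOf i = D.printedIndex i := rfl

/-- **Def. 4.2.2, diagonal clause — reconciled**: every point of T-07's `Σ̃_{L′}` satisfies T-08's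
`IsDiagonalOffBad` (T-07's `IsDiagonalAt z w` for `w ∉ V^{odd,ss}`). [folklore] -/
theorem isDiagonalOffBad_of_mem {z : D.Tuple} (hz : z ∈ D.adelicAnsatz) :
    E.toAnsatzCurveDatum.IsDiagonalOffBad z := by
  intro w hw i
  exact (hz.1 w hw) i

/-- A standard Ansatz point of the reconciled carrier is, in T-07's vocabulary, a Θ^{gau}-Link (Def. 4.2.3.1,
`thetaGauLinkEquiv`) whose TARGET `y_{ℓ⋇}` is a standard point of `𝒴′_{L′}` (§4.5 "standard Θ-Link"). [folklore] -/
theorem isStandardAnsatzPoint_iff (z : D.Tuple) :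
    E.toAnsatzCurveDatum.IsStandardAnsatzPoint z ↔
      z ∈ D.adelicAnsatz ∧ E.toAnsatzCurveDatum.IsStandardPoint (z D.jLast) := Iff.rfl

/-- **§4.5 "standard Θ-Link" in T-07's vocabulary**: a standard Ansatz point `z_Θ` of the reconciled carrier as a
`Θ^{gau}`-Link (Def. 4.2.3.1, `ThetaGauLink`) — «`z_Θ ∈ Σ̃_{L′}` which one may think of as a standard Θ-Link»
(p.36 l.11–13). [claim: Joshi2024ATS3, status: disputed] -/
def standardThetaGauLink {z : D.Tuple} (h : E.toAnsatzCurveDatum.IsStandardAnsatzPoint z) : D.ThetaGauLink :=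
  ⟨z, h.1⟩

/-- Its TARGET `y_{ℓ⋇}` (T-07's `ThetaGauLink.target`) is a standard point of `𝒴′_{L′}`: over the canonical points at
every `w ∈ V^non` (Prop. 4.4.1). [folklore] -/
theorem standardThetaGauLink_target_standard {z : D.Tuple} (h : E.toAnsatzCurveDatum.IsStandardAnsatzPoint z) :
    E.toAnsatzCurveDatum.IsStandardPoint (E.standardThetaGauLink h).target := h.2

end StandardPointData

/-- The data of [J-III] §4.6 over T-07's carrier (a number field `L` = Joshi's `L′`): the residue fields `K_{y_w}`
with `|−|_{K_{y_w}}` and `L′ ↪ K_{y_w}` ([J-IIh] Def. 5.1.1), `emb_cofinite` ([J-IIh] Lem. 5.4.2), normalization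
coordinates `α_y > 0` ([J-IIh] (5.3.5)), standard absolute values ([J-IIh] (5.3.1)), and the EVALUATION of `L′` in
T-07's common domain `T p_w` on which T-07 reads the residue valuations (its modelling choice (d)), with the
compatibility `|emb x|_{K_{y_w}} = absK w y (evalL w x)` identifying the two readings of `|−|_{K_{y_w}}` on `L′`.
SIGNATURE. [claim: Joshi2024ATS3, status: disputed] -/
structure ResidueFieldData (L : Type) [Field L] extends D.StandardPointData where
  /-- the residue field `K_{y_w}` -/
  K : ∀ w : D.V, D.Y w → Type
  /-- `K_{y_w}` is a field -/
  [instField : ∀ (w : D.V) (y : D.Y w), Field (K w y)]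
  /-- `|−|_{K_{y_w}}` -/
  abs : ∀ (w : D.V) (y : D.Y w), AbsoluteValue (K w y) ℝ
  /-- `L′ ↪ K_{y_w}` -/
  emb : ∀ (w : D.V) (y : D.Y w), L →+* K w y
  /-- `x ∈ L′^*` is a `K_{y_w}`-unit for almost all `w` -/
  emb_cofinite : ∀ (y : ∀ w, D.Y w) (x : L), x ≠ 0 → ∀ᶠ w in cofinite, abs w (y w) (emb w (y w) x) = 1
  /-- normalization coordinates -/
  α : (∀ w, D.Y w) → D.V → ℝ
  /-- positivity -/
  α_pos : ∀ y w, 0 < α y w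
  /-- standard absolute values of `L′` -/
  stdAbs : D.V → AbsoluteValue L ℝ
  /-- `L′ → T p_w`: the elements of `L′` as points of T-07's evaluation domain -/
  evalL : ∀ w : D.V, L → D.T (D.pOf w)
  /-- the two readings of `|−|_{K_{y_w}}` agree on `L′` -/
  abs_emb : ∀ (w : D.V) (y : D.Y w) (x : L), abs w y (emb w y x) = D.absK w y (evalL w x)

namespace ResidueFieldData

variable {D} {L : Type} [Field L] (R : D.ResidueFieldData L)

/-- T-08's `ArithPeriodDatum` built from T-07's carrier and the §4.6 data. [claim: Joshi2024ATS3, status: disputed] -/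
def toArithPeriodDatum : ArithPeriodDatum L where
  toAnsatzCurveDatum := R.toStandardPointData.toAnsatzCurveDatum
  K := R.K
  instField := R.instField
  abs := R.abs
  emb := R.emb
  emb_cofinite := R.emb_cofinite
  α := R.α
  α_pos := R.α_pos
  stdAbs := R.stdAbs

/-- The Ansatz of the reconciled period carrier IS T-07's `adelicAnsatz`. [folklore] -/
@[simp] theorem toArithPeriodDatum_ansatz : R.toArithPeriodDatum.ansatz = D.adelicAnsatz := rfl

end ResidueFieldData

end AdelicCurveDatum

/-! ## 3. [J-III] Rmk. 4.6.2 (1)–(3) (p.37 l.46–p.38 l.8) -/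

namespace ArithPeriodDatum

variable {L : Type} [Field L] (D : ArithPeriodDatum L)

/-- **[J-III] Rmk. 4.6.2 (1) (p.37 l.47–48)**: "I expect that the above period mapping is continuous for a suitable
topology on the codomain, but I hope to take this up in a separate paper." An EXPECTATION of the author, not an
assertion: typed as the Prop "the period map (Thm. 4.6.1 (6)) is continuous on `Σ̃_{L′}`" for GIVEN topologies on the
factors `|Y_{C♭_{p_w},L′_w}|` (product topology on tuples, [J-III] p.30 l.30 "topological space"; [J-IIh] Lem. 4.1.2)
and on the codomain (the "suitable topology" left open in print — a parameter here). Untagged on purpose (no claim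
is made in print); never asserted. -/
def PeriodMapContinuousOn [∀ w : D.V, TopologicalSpace (D.Y w)]
    [TopologicalSpace (Fin D.lstar → Submodule ℝ (D.V →₀ ℝ))] : Prop :=
  ContinuousOn D.periodMap D.ansatz

/-- **[J-III] Rmk. 4.6.2 (3) (p.38 l.1–8) = [J-IIh] Rmk. 5.10.2 (4)**: "in the context of [IUTchIII, Corollary 3.12]
Mochizuki considers (without a transparent proof) a version of this construction by means of the theory of realified
Frobenioid `Frob(L)^ℝ` of `L` (see my discussion of this Frobenioid is in §10). Specifically Mochizuki works with the
tuple of realified Frobenioids `(Frob(L)^ℝ_1, …, Frob(L)^ℝ_{ℓ⋇})` which provides, by the same degree mapping, the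
hyperplanes considered here." Typed over ABSTRACT data — one `ℝ`-linear degree functional per label on the common
coordinate space `V_L = ⊕_v ℝ` (the arithmetic-divisor reading of a realified global Frobenioid's degree; Joshi's §10
is slot T-34) —: the degree-zero hyperplanes of the `ℓ⋇` realified Frobenioids ARE the period hyperplanes
`(H_{y_1}, …, H_{y_{ℓ⋇}})` of the Ansatz point `z`. DICTIONARY (by name only, E-PLAN R14 / row D-12): OUR typing of
the realified global Frobenioids of [IUTchIII] Thm. 3.11 (i) (c) is `Summit.ABC.IUTFork.Thm311.GlobalDegrees` (field
`deg`) with the clause `Summit.ABC.IUTFork.Thm311.DegreesViaLogvol`. Rmk. 4.6.2 (2) (p.37 l.49–50), LOCATOR ONLY: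
"Mochizuki's discussion of the role of product formulas is in [IUTchIII, Remark 3.9.6], [IUTchI, Remark 5.2.1],
[Mochizuki, 2020, Page 71]." HYPOTHESIS (a correspondence asserted in print), never asserted here; located, not
adjudicated. [claim: Joshi2024ATS3, status: disputed] -/
@[claim "Joshi2024ATS3" "disputed"]
def FrobenioidDegreesGiveHyperplanes (frobDeg : Fin D.lstar → ((D.V →₀ ℝ) →ₗ[ℝ] ℝ)) (z : D.Tuple) : Prop :=
  ∀ i : Fin D.lstar, LinearMap.ker (frobDeg i) = D.hyperplane (z i)

/-- Rmk. 4.6.2 (3) holds TAUTOLOGICALLY for the degree functionals the period carrier itself supplies (`degFunctional`,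
[J-IIh] Def. 5.4.3) — recorded to make explicit that the content of (3) is the IDENTIFICATION of Mochizuki's
realified-Frobenioid degrees with these functionals (dictionary row D-12), not a property of `hyperplane`. [folklore] -/
theorem frobenioidDegreesGiveHyperplanes_self (z : D.Tuple) :
    D.FrobenioidDegreesGiveHyperplanes (fun i => D.degFunctional (z i)) z := fun _ => rfl

end ArithPeriodDatum

end Summit.ABC.IUTFork.Joshi
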